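import Summits.QuantumFields.YangMills.Theorems.UnitScaleTiltProp8ChartDoubleBarAbelian
import HarnessLib

/-!
# Route `UnitScaleTilt`, crux K1 «MinimiserStabilityRegPr» (stmt-QuantumFields-19200), stub V2′ `stub_halvingStep` — the (H-E2E) census, row S11, trivial inputs BY NAME:
# **THE COMPETITOR BALL IS OPEN ALONG LINES (`hS₀`) AND THE REAL-KERNEL EXTENSION `Hs` IS TRACE∕ADJOINT-COMPATIBLE (`hHs` of ✓p618069∕✓p619878∕✓p620806)**

Cell `ym3-torus` (HUMAN RULING D-0037: YM₃ on the torus is ladder rung R3, not the Clay problem), width seat `ym-ust-19200-w8` g0∕s2.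
`--supports stmt-QuantumFields-19200 --as helper`; definition-free, 0 sorry.

WHAT THIS FILE PROVES (no definition, no sorry):
* §1 **`exists_lineRadius_of_mem_weightedBall`** — for `A` in the strict weighted ball `{X | ∀ b, w b·‖X b‖ < R}` (finitely many bonds) and every direction `δ`, some `r > 0` keeps
  `A + t•δ` in the ball for `|t| < r` — the `hS₀` input of ✓`HalvingDressedCriticalitySU2.tracePairing_of_isMinOn_dressed_wilson_su2` at `S₀ :=` the weighted ball of record.
* §2 for a real-kernel extension `Hs X b = Σ_c k(b,c) • X c` (spec (i) of ✓`exists_flatH_scaledExt`): **`trace_apply_of_realKernel_eq_zero`** (traceless data ⇒ traceless field — the `hHs` of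
  ✓`trace_dsel_eq_zero_of_eq49`), **`traceProj_apply_of_realKernel`** (commutes with `M ↦ M − (tr M)•1` — the `hHs` of ✓`trace_dressed_chartOfRecord`),
  **`isSelfAdjoint_apply_of_realKernel`** (self-adjoint data ⇒ self-adjoint field; the `hHs` of ✓`isSelfAdjoint_dressed_chartOfRecord` is ✓`star_apply_of_realKernel`).
HONEST SCOPE.  Plumbing; the P5-entry knit itself (choosing `S₀`, `Bdat`, the chart `U` via ✓`exists_su2Chart` at the dressed competitor) is ★w7-19200's.  NOT a claim about the stub,
the crux, the rung or the mass gap.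

References: T. Bałaban, CMP **102** (1985) [Balaban1985Variational] (45)–(47) p.285, (157)–(158) p.302.
-/

set_option autoImplicit false

noncomputable section

open scoped BigOperators

namespace Summit.QuantumFields.YangMills.Theorems.Prop8ChartDoubleBar

open scoped Matrix.Norms.L2Operator

/-! ## §1 The strict weighted ball is open along lines -/

/-- **`hS₀` FOR THE WEIGHTED BALL**: if `w b·‖A b‖ < R` for every `b` (finitely many bonds, `w ≥ 0`), then for every direction `δ` there is `r > 0` with `w b·‖(A + t•δ) b‖ < R` for all
`|t| < r` and all `b`. [cite: Balaban1985Variational, (157)-(158) p.302] -/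
theorem exists_lineRadius_of_mem_weightedBall {ι V : Type*} [Fintype ι] [NormedAddCommGroup V] [NormedSpace ℝ V] (w : ι → ℝ) (hw : ∀ b, 0 ≤ w b) {R : ℝ}
    {A : ι → V} (hA : ∀ b, w b * ‖A b‖ < R) (δ : ι → V) :
    ∃ r : ℝ, 0 < r ∧ ∀ t : ℝ, |t| < r → ∀ b, w b * ‖(A + t • δ) b‖ < R := by
  classical
  -- per-bond slack and a uniform radius
  have hslack : ∀ b, 0 < R - w b * ‖A b‖ := fun b => by linarith [hA b]
  set f : ι → ℝ := fun b => (R - w b * ‖A b‖) / (w b * ‖δ b‖ + 1) with hf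
  have hf0 : ∀ b, 0 < f b := fun b => div_pos (hslack b) (by have := hw b; positivity)
  by_cases hι : Nonempty ι
  · obtain ⟨b₀, -, hb₀⟩ := Finset.exists_min_image Finset.univ f (Finset.univ_nonempty_iff.2 hι)
    refine ⟨f b₀, hf0 b₀, fun t ht b => ?_⟩
    have hfb : |t| < f b := lt_of_lt_of_le ht (hb₀ b (Finset.mem_univ b))
    have hden : 0 < w b * ‖δ b‖ + 1 := by have := hw b; positivity
    have h1 : |t| * (w b * ‖δ b‖ + 1) < R - w b * ‖A b‖ := by
      have := (lt_div_iff₀ hden).1 (by rw [hf] at hfb; exact hfb)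
      exact this
    calc w b * ‖(A + t • δ) b‖ = w b * ‖A b + t • δ b‖ := rfl
      _ ≤ w b * (‖A b‖ + |t| * ‖δ b‖) := by
          refine mul_le_mul_of_nonneg_left ((norm_add_le _ _).trans ?_) (hw b)
          rw [norm_smul, Real.norm_eq_abs]
      _ = w b * ‖A b‖ + |t| * (w b * ‖δ b‖) := by ring
      _ ≤ w b * ‖A b‖ + |t| * (w b * ‖δ b‖ + 1) := by
          have : 0 ≤ |t| := abs_nonneg t
          nlinarith
      _ < R := by linarith
  · exact ⟨1, one_pos, fun t _ b => absurd ⟨b⟩ hι⟩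

/-! ## §2 The real-kernel extension is trace- and adjoint-compatible -/

/-- traceless data give a traceless field. [cite: Balaban1985Variational, (45) p.285] -/
theorem trace_apply_of_realKernel_eq_zero {ι κ : Type*} [Fintype κ] (Hs : (κ → Matrix (Fin 2) (Fin 2) ℂ) → (ι → Matrix (Fin 2) (Fin 2) ℂ)) (k : ι → κ → ℝ)
    (hHs : ∀ X b, Hs X b = ∑ c, k b c • X c) (X : κ → Matrix (Fin 2) (Fin 2) ℂ) (hX : ∀ c, Matrix.trace (X c) = 0) (b : ι) :
    Matrix.trace (Hs X b) = 0 := by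
  rw [hHs, Matrix.trace_sum]
  exact Finset.sum_eq_zero fun c _ => by rw [Matrix.trace_smul, hX c, smul_zero]

/-- the real-kernel extension commutes with the traceless projection `M ↦ M − (tr M)•1`. [cite: Balaban1985Variational, (45) p.285] -/
theorem traceProj_apply_of_realKernel {ι κ : Type*} [Fintype κ] (Hs : (κ → Matrix (Fin 2) (Fin 2) ℂ) → (ι → Matrix (Fin 2) (Fin 2) ℂ)) (k : ι → κ → ℝ)
    (hHs : ∀ X b, Hs X b = ∑ c, k b c • X c) (X : κ → Matrix (Fin 2) (Fin 2) ℂ) (b : ι) :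
    Hs X b - Matrix.trace (Hs X b) • (1 : Matrix (Fin 2) (Fin 2) ℂ) = Hs (fun c => X c - Matrix.trace (X c) • (1 : Matrix (Fin 2) (Fin 2) ℂ)) b := by
  rw [hHs, hHs, Matrix.trace_sum, Finset.sum_smul, ← Finset.sum_sub_distrib]
  exact Finset.sum_congr rfl fun c _ => by rw [Matrix.trace_smul, smul_sub, smul_assoc]

/-- self-adjoint data give a self-adjoint field (✓`star_apply_of_realKernel`). [cite: Balaban1985Variational, (45) p.285] -/
theorem isSelfAdjoint_apply_of_realKernel {ι κ : Type*} [Fintype κ] (Hs : (κ → Matrix (Fin 2) (Fin 2) ℂ) → (ι → Matrix (Fin 2) (Fin 2) ℂ)) (k : ι → κ → ℝ)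
    (hHs : ∀ X b, Hs X b = ∑ c, k b c • X c) (X : κ → Matrix (Fin 2) (Fin 2) ℂ) (hX : ∀ c, IsSelfAdjoint (X c)) (b : ι) :
    IsSelfAdjoint (Hs X b) := by
  show star (Hs X b) = Hs X b
  rw [star_apply_of_realKernel Hs k hHs X b]
  congr 1
  funext c
  exact (hX c).star_eq

/-- **THE DRESSED COMPETITOR IS 𝔰𝔲(2)-VALUED** (the three S11 rows together, for the real-kernel `Hs`): at a bondwise self-adjoint traceless `X` with the dressed point in the weighted
ball of record and `Dv` THE small solution of (49) there (FILE E's shapes), `X − Hs Dv` is bondwise self-adjoint AND traceless — so ✓`exists_su2Chart` charts it.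
[cite: Balaban1985Variational, (47)-(49) pp.285-286, (157)-(158) p.302] -/
theorem dressed_competitor_su2 (F : Literature.MathematicalPhysics.QuantumFieldTheory.Balaban1983to89.T3ContinuumYM3Torus.T3Family) (n K : ℕ)
    (D : Literature.MathematicalPhysics.QuantumFieldTheory.Balaban1983to89.B6SectADomainsV1.Domains (F.P K)) (hDk : D.k = K - n)
    (hcollar : ∀ (i : ℕ) (e : Literature.MathematicalPhysics.QuantumFieldTheory.Balaban1983to89.PBond (F.P K) (i + 1)), D.LamBond (i + 1) e →
      ∀ z : Literature.MathematicalPhysics.QuantumFieldTheory.Balaban1983to89.Site (F.P K) i,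
        (Literature.MathematicalPhysics.QuantumFieldTheory.Balaban1983to89.blockOf z = e.src ∨
          Literature.MathematicalPhysics.QuantumFieldTheory.Balaban1983to89.blockOf z = e.tgt) → z ∈ D.Om i)
    {w : ℕ → Literature.MathematicalPhysics.QuantumFieldTheory.Balaban1983to89.PBond (F.P K) 0 → ℝ} (hw : FlatCubeOpsText.IsLevWeight F n K D w)
    {R : ℝ} (hR : 16 * 3800 * ((((F.P K).d + 2) * (F.P K).L : ℕ) : ℝ) ^ 2 * (F.L : ℝ) * R ≤ 1)
    (Hs : (Literature.MathematicalPhysics.QuantumFieldTheory.Balaban1983to89.B6SectAOperatorsV1.BondIdx D → Matrix (Fin 2) (Fin 2) ℂ) →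
      (Literature.MathematicalPhysics.QuantumFieldTheory.Balaban1983to89.PBond (F.P K) 0 → Matrix (Fin 2) (Fin 2) ℂ))
    (k : Literature.MathematicalPhysics.QuantumFieldTheory.Balaban1983to89.PBond (F.P K) 0 →
      Literature.MathematicalPhysics.QuantumFieldTheory.Balaban1983to89.B6SectAOperatorsV1.BondIdx D → ℝ)
    (hHs : ∀ X b, Hs X b = ∑ c, k b c • X c)
    {X : Literature.MathematicalPhysics.QuantumFieldTheory.Balaban1983to89.PBond (F.P K) 0 → Matrix (Fin 2) (Fin 2) ℂ}
    (hXsa : ∀ b, IsSelfAdjoint (X b)) (hXtr : ∀ b, Matrix.trace (X b) = 0)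
    {Dv : Literature.MathematicalPhysics.QuantumFieldTheory.Balaban1983to89.B6SectAOperatorsV1.BondIdx D → Matrix (Fin 2) (Fin 2) ℂ} {t : ℝ}
    (hball : ∀ b, w 1 b * ‖(X - Hs Dv) b‖ < R)
    (h49 : chartLogFlat (((F.L : ℝ)⁻¹) ^ (K - n)) D (X - Hs Dv) -
        (fderiv ℂ (chartLogFlat (((F.L : ℝ)⁻¹) ^ (K - n)) D :
          (Literature.MathematicalPhysics.QuantumFieldTheory.Balaban1983to89.PBond (F.P K) 0 → Matrix (Fin 2) (Fin 2) ℂ) →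
            Literature.MathematicalPhysics.QuantumFieldTheory.Balaban1983to89.B6SectAOperatorsV1.BondIdx D → Matrix (Fin 2) (Fin 2) ℂ) 0) (X - Hs Dv) = Dv)
    (hsize : ∀ c, ‖Dv c‖ ≤ t)
    (huniq : ∀ D' : Literature.MathematicalPhysics.QuantumFieldTheory.Balaban1983to89.B6SectAOperatorsV1.BondIdx D → Matrix (Fin 2) (Fin 2) ℂ, (∀ c, ‖D' c‖ ≤ t) →
      chartLogFlat (((F.L : ℝ)⁻¹) ^ (K - n)) D (X - Hs D') -
        (fderiv ℂ (chartLogFlat (((F.L : ℝ)⁻¹) ^ (K - n)) D :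
          (Literature.MathematicalPhysics.QuantumFieldTheory.Balaban1983to89.PBond (F.P K) 0 → Matrix (Fin 2) (Fin 2) ℂ) →
            Literature.MathematicalPhysics.QuantumFieldTheory.Balaban1983to89.B6SectAOperatorsV1.BondIdx D → Matrix (Fin 2) (Fin 2) ℂ) 0) (X - Hs D') = D' →
      D' = Dv) :
    (∀ b, IsSelfAdjoint ((X - Hs Dv) b)) ∧ ∀ b, Matrix.trace ((X - Hs Dv) b) = 0 :=
  ⟨(isSelfAdjoint_dressed_chartOfRecord F n K D hDk hcollar hw hR Hs (star_apply_of_realKernel Hs k hHs) hXsa hball h49 hsize huniq).2,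
    (trace_dsel_eq_zero_of_eq49 F n K D hDk hcollar hw hR Hs (trace_apply_of_realKernel_eq_zero Hs k hHs) hball h49).2 hXtr⟩

end Summit.QuantumFields.YangMills.Theorems.Prop8ChartDoubleBar

end
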